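import Mathlib
import Summits.Parity.BatemanHorn.Theorems.IsogenyRedeiSplitBlockJacobiCells
import HarnessLib

/-!
# The bulk pair set sorted into cells (helper toward `stub_poissonReduction`, line
`cofactor-root-discrepancy`, crux `SplitBlockJacobi`, stmt-Parity-11583)

For the line's bulk set of free prime pairs
`bulk = {(Q, Q′) : Q ≡ Q′ ≡ 1 (4) primes, x^θ < Q < Q′, QQ′ ≤ x² + 1, QQ′ ≤ X}` and a monotone
grid `g` with `g 0 = ⌊x^θ⌋`, we identify the cell pieces `bulk ∩ ((g_i, g_{i+1}] × (g_j, g_{j+1}])`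
of GOOD cells (`g_{i+1} g_{j+1} ≤ X`): a full rectangle of prime pairs for `i < j`
(`bulk_cell_eq_rect`), its `Q < Q′` half on the diagonal (`bulk_cell_diag_eq`), empty for `i > j`
(`bulk_cell_eq_empty`); pairs outside the good cells lie in a BAD cell (`mem_bad_cell_of_mem_sdiff`);
the diagonal half-sum is half the full sum for Jacobi-twisted weights depending on `QQ′`
(`sum_diag_jacobi_eq_half`, quadratic reciprocity for `Q ≡ 1 (4)`).
-/

noncomputable section

open Finset

namespace Summit.Parity.BatemanHorn.Cruxes.SplitBlockJacobi.CofactorRootDiscrepancy.Poisson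

/-- The bulk pair set of the line at height `X` (local notation; for `X = x^{2-μ}` it is literally
the index set of the skeleton's `Dbulk θ μ x`). -/
local notation3 (prettyPrint := false) "bulkSet[" θ ", " x ", " X "]" =>
  (((Finset.range ((x : ℕ) ^ 2 + 2) ×ˢ Finset.range ((x : ℕ) ^ 2 + 2)).filter (fun q : ℕ × ℕ =>
    q.1.Prime ∧ q.2.Prime ∧ q.1 % 4 = 1 ∧ q.2 % 4 = 1 ∧ ((x : ℕ) : ℝ) ^ (θ : ℝ) < (q.1 : ℝ) ∧
      q.1 < q.2 ∧ q.1 * q.2 ≤ (x : ℕ) ^ 2 + 1)).filter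
    (fun q : ℕ × ℕ => ((q.1 * q.2 : ℕ) : ℝ) ≤ (X : ℝ)))

/-! ### Membership in the bulk -/

/-- Unfolding membership in the bulk set. -/
theorem mem_bulk_iff (θ : ℝ) (x : ℕ) (X : ℝ) (q : ℕ × ℕ) :
    q ∈ bulkSet[θ, x, X] ↔ (q.1 < x ^ 2 + 2 ∧ q.2 < x ^ 2 + 2) ∧
      (q.1.Prime ∧ q.2.Prime ∧ q.1 % 4 = 1 ∧ q.2 % 4 = 1 ∧ (x : ℝ) ^ θ < (q.1 : ℝ) ∧
        q.1 < q.2 ∧ q.1 * q.2 ≤ x ^ 2 + 1) ∧ ((q.1 * q.2 : ℕ) : ℝ) ≤ X := by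
  rw [Finset.mem_filter, Finset.mem_filter, Finset.mem_product, Finset.mem_range, Finset.mem_range,
    and_assoc]

/-- A sufficient condition for membership in the bulk: prime pair `Q < Q′`, `≡ 1 (4)`,
`x^θ < Q`, `QQ′ ≤ X ≤ x²`. -/
theorem mem_bulk_of (θ : ℝ) (x : ℕ) {X : ℝ} (hX : X ≤ (x : ℝ) ^ 2) {q : ℕ × ℕ}
    (h1 : q.1.Prime) (h2 : q.2.Prime) (h41 : q.1 % 4 = 1) (h42 : q.2 % 4 = 1)
    (hθ : (x : ℝ) ^ θ < (q.1 : ℝ)) (hlt : q.1 < q.2) (hqX : ((q.1 * q.2 : ℕ) : ℝ) ≤ X) :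
    q ∈ bulkSet[θ, x, X] := by
  rw [mem_bulk_iff]
  have hprod : q.1 * q.2 ≤ x ^ 2 := by
    have : ((q.1 * q.2 : ℕ) : ℝ) ≤ ((x ^ 2 : ℕ) : ℝ) := by
      rw [Nat.cast_pow]; exact hqX.trans hX
    exact_mod_cast this
  have h1' : 1 ≤ q.1 := h1.one_lt.le
  have h2' : 1 ≤ q.2 := h2.one_lt.le
  refine ⟨⟨by nlinarith, by nlinarith⟩, ⟨h1, h2, h41, h42, hθ, hlt, by omega⟩, hqX⟩

/-! ### The cell pieces of good cells -/

/-- **Off-diagonal good cell**: for `i < j` and `g_{i+1} g_{j+1} ≤ X ≤ x²`, the bulk pairs in the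
cell are exactly the prime pairs `≡ 1 (4)` of the rectangle. -/
theorem bulk_cell_eq_rect (θ : ℝ) (x : ℕ) {X : ℝ} (hX : X ≤ (x : ℝ) ^ 2) {g : ℕ → ℕ}
    (hg : Monotone g) (hg0 : g 0 = ⌊(x : ℝ) ^ θ⌋₊) {i j : ℕ} (hij : i < j)
    (hgood : ((g (i + 1) * g (j + 1) : ℕ) : ℝ) ≤ X) :
    (bulkSet[θ, x, X]).filter (fun q : ℕ × ℕ =>
        q.1 ∈ Finset.Ioc (g i) (g (i + 1)) ∧ q.2 ∈ Finset.Ioc (g j) (g (j + 1))) =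
      (Finset.Ioc (g i) (g (i + 1)) ×ˢ Finset.Ioc (g j) (g (j + 1))).filter
        (fun q : ℕ × ℕ => (q.1.Prime ∧ q.1 % 4 = 1) ∧ (q.2.Prime ∧ q.2 % 4 = 1)) := by
  ext q
  rw [Finset.mem_filter, mem_bulk_iff, Finset.mem_filter, Finset.mem_product]
  constructor
  · rintro ⟨⟨-, ⟨h1, h2, h41, h42, -, -, -⟩, -⟩, hc1, hc2⟩
    exact ⟨⟨hc1, hc2⟩, ⟨h1, h41⟩, ⟨h2, h42⟩⟩
  · rintro ⟨⟨hc1, hc2⟩, ⟨h1, h41⟩, ⟨h2, h42⟩⟩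
    refine ⟨?_, hc1, hc2⟩
    rw [Finset.mem_Ioc] at hc1 hc2
    have hθq : (x : ℝ) ^ θ < (q.1 : ℝ) := by
      have h0 : g 0 ≤ g i := hg (Nat.zero_le i)
      have : ⌊(x : ℝ) ^ θ⌋₊ < q.1 := by rw [← hg0]; omega
      exact (Nat.floor_lt (by positivity)).mp this
    have hlt : q.1 < q.2 := by
      have : g (i + 1) ≤ g j := hg (by omega)
      omega
    have hqX : ((q.1 * q.2 : ℕ) : ℝ) ≤ X := by
      refine le_trans ?_ hgood
      exact_mod_cast Nat.mul_le_mul hc1.2 hc2.2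
    exact (mem_bulk_iff θ x X q).mp (mem_bulk_of θ x hX h1 h2 h41 h42 hθq hlt hqX)

/-- **Diagonal good cell**: the bulk pairs in the cell `(i, i)` are the prime pairs `≡ 1 (4)` of
the square with `Q < Q′`. -/
theorem bulk_cell_diag_eq (θ : ℝ) (x : ℕ) {X : ℝ} (hX : X ≤ (x : ℝ) ^ 2) {g : ℕ → ℕ}
    (hg : Monotone g) (hg0 : g 0 = ⌊(x : ℝ) ^ θ⌋₊) {i : ℕ}
    (hgood : ((g (i + 1) * g (i + 1) : ℕ) : ℝ) ≤ X) :
    (bulkSet[θ, x, X]).filter (fun q : ℕ × ℕ =>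
        q.1 ∈ Finset.Ioc (g i) (g (i + 1)) ∧ q.2 ∈ Finset.Ioc (g i) (g (i + 1))) =
      (Finset.Ioc (g i) (g (i + 1)) ×ˢ Finset.Ioc (g i) (g (i + 1))).filter
        (fun q : ℕ × ℕ => ((q.1.Prime ∧ q.1 % 4 = 1) ∧ (q.2.Prime ∧ q.2 % 4 = 1)) ∧ q.1 < q.2) := by
  ext q
  rw [Finset.mem_filter, mem_bulk_iff, Finset.mem_filter, Finset.mem_product]
  constructor
  · rintro ⟨⟨-, ⟨h1, h2, h41, h42, -, hlt, -⟩, -⟩, hc1, hc2⟩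
    exact ⟨⟨hc1, hc2⟩, ⟨⟨h1, h41⟩, ⟨h2, h42⟩⟩, hlt⟩
  · rintro ⟨⟨hc1, hc2⟩, ⟨⟨h1, h41⟩, ⟨h2, h42⟩⟩, hlt⟩
    refine ⟨?_, hc1, hc2⟩
    rw [Finset.mem_Ioc] at hc1 hc2
    have hθq : (x : ℝ) ^ θ < (q.1 : ℝ) := by
      have h0 : g 0 ≤ g i := hg (Nat.zero_le i)
      have : ⌊(x : ℝ) ^ θ⌋₊ < q.1 := by rw [← hg0]; omega
      exact (Nat.floor_lt (by positivity)).mp this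
    have hqX : ((q.1 * q.2 : ℕ) : ℝ) ≤ X := by
      refine le_trans ?_ hgood
      exact_mod_cast Nat.mul_le_mul hc1.2 hc2.2
    exact (mem_bulk_iff θ x X q).mp (mem_bulk_of θ x hX h1 h2 h41 h42 hθq hlt hqX)

/-- **Cells below the diagonal are empty** (`j < i`). -/
theorem bulk_cell_eq_empty (θ : ℝ) (x : ℕ) (X : ℝ) {g : ℕ → ℕ} (hg : Monotone g) {i j : ℕ}
    (hji : j < i) :
    (bulkSet[θ, x, X]).filter (fun q : ℕ × ℕ =>
        q.1 ∈ Finset.Ioc (g i) (g (i + 1)) ∧ q.2 ∈ Finset.Ioc (g j) (g (j + 1))) = ∅ := by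
  rw [Finset.filter_eq_empty_iff]
  rintro q hq ⟨hc1, hc2⟩
  rw [mem_bulk_iff] at hq
  rw [Finset.mem_Ioc] at hc1 hc2
  have : g (j + 1) ≤ g i := hg (by omega)
  have hlt := hq.2.1.2.2.2.2.2.1
  omega

/-! ### Pairs outside the good cells lie in a bad cell -/

/-- A bulk pair not in any good cell (cells indexed by `(range I)²` filtered by goodness) lies in
some cell `(i, j)`, `i, j < I`, which is bad: `X < g_{i+1} g_{j+1}`; moreover it is a prime pair
`Q < Q′` with `1 ≤ Q ≤ x` and `QQ′ ≤ X`. Requires `x² + 2 ≤ g I`. -/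
theorem mem_bad_cell_of_mem_sdiff (θ : ℝ) (x : ℕ) (X : ℝ) {g : ℕ → ℕ}
    (hg0 : g 0 = ⌊(x : ℝ) ^ θ⌋₊) {I : ℕ} (hI : x ^ 2 + 2 ≤ g I) {q : ℕ × ℕ}
    (hq : q ∈ bulkSet[θ, x, X] \ ((Finset.range I ×ˢ Finset.range I).filter
        (fun ij : ℕ × ℕ => ((g (ij.1 + 1) * g (ij.2 + 1) : ℕ) : ℝ) ≤ X)).biUnion
        (fun ij : ℕ × ℕ => (bulkSet[θ, x, X]).filter (fun q : ℕ × ℕ =>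
          q.1 ∈ Finset.Ioc (g ij.1) (g (ij.1 + 1)) ∧ q.2 ∈ Finset.Ioc (g ij.2) (g (ij.2 + 1))))) :
    q.1.Prime ∧ q.2.Prime ∧ q.1 < q.2 ∧ 1 ≤ q.1 ∧ q.1 ≤ x ∧ ((q.1 * q.2 : ℕ) : ℝ) ≤ X ∧
      ∃ i j : ℕ, i < I ∧ j < I ∧ q.1 ∈ Finset.Ioc (g i) (g (i + 1)) ∧
        q.2 ∈ Finset.Ioc (g j) (g (j + 1)) ∧ X < ((g (i + 1) * g (j + 1) : ℕ) : ℝ) := by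
  obtain ⟨hqB, hnot⟩ := not_mem_cell_of_mem_sdiff hq
  have hqB' := (mem_bulk_iff θ x X q).mp hqB
  obtain ⟨⟨hr1, hr2⟩, ⟨h1, h2, -, -, hθ, hlt, hle⟩, hqX⟩ := hqB'
  have hq1x : q.1 ≤ x := by nlinarith
  -- locate the cells of the two coordinates
  have hg0q1 : g 0 < q.1 := by rw [hg0]; exact (Nat.floor_lt (by positivity)).mpr hθ
  have hg0q2 : g 0 < q.2 := hg0q1.trans hlt
  obtain ⟨i, hi, hci⟩ := exists_cell_of_mem I q.1 hg0q1 (by omega)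
  obtain ⟨j, hj, hcj⟩ := exists_cell_of_mem I q.2 hg0q2 (by omega)
  refine ⟨h1, h2, hlt, h1.one_lt.le, hq1x, hqX, i, j, hi, hj, hci, hcj, ?_⟩
  by_contra hbad
  push Not at hbad
  refine hnot (i, j) ?_ ⟨hci, hcj⟩
  rw [Finset.mem_filter, Finset.mem_product, Finset.mem_range, Finset.mem_range]
  exact ⟨⟨hi, hj⟩, hbad⟩

/-! ### The diagonal cell: half of the symmetric sum -/

/-- For weights `Φ` depending on the product only:
`Σ_{Q<Q′ in square, ≡1 (4) primes} (Q|Q′) Φ(QQ′) = ½ Σ_{square, ≡1 (4) primes} (Q|Q′) Φ(QQ′)`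
(quadratic reciprocity: `(Q|Q′) = (Q′|Q)` for `Q ≡ Q′ ≡ 1 (4)`, and `(Q|Q) = 0`). -/
theorem sum_diag_jacobi_eq_half (s : Finset ℕ) (Φ : ℕ → ℝ) :
    ∑ q ∈ (s ×ˢ s).filter (fun q : ℕ × ℕ =>
        ((q.1.Prime ∧ q.1 % 4 = 1) ∧ (q.2.Prime ∧ q.2 % 4 = 1)) ∧ q.1 < q.2),
      (jacobiSym (q.1 : ℤ) q.2 : ℝ) * Φ (q.1 * q.2) =
      (1 / 2) * ∑ q ∈ (s ×ˢ s).filter (fun q : ℕ × ℕ =>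
        (q.1.Prime ∧ q.1 % 4 = 1) ∧ (q.2.Prime ∧ q.2 % 4 = 1)),
      (jacobiSym (q.1 : ℤ) q.2 : ℝ) * Φ (q.1 * q.2) := by
  refine sum_filter_lt_eq_half s (fun Q : ℕ => Q.Prime ∧ Q % 4 = 1)
    (fun q : ℕ × ℕ => (jacobiSym (q.1 : ℤ) q.2 : ℝ) * Φ (q.1 * q.2)) ?_ ?_
  · intro Q _ Q' _ hQ hQ'
    simp only
    rw [jacobiSym.quadratic_reciprocity_one_mod_four hQ.2 (Nat.odd_iff.mpr (by omega)),
      Nat.mul_comm]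
  · intro Q _ hQ
    simp only
    rw [jacobiSym.eq_zero_iff.mpr ⟨hQ.1.ne_zero, by
      rw [Int.gcd_natCast_natCast, Nat.gcd_self]; exact hQ.1.one_lt.ne'⟩]
    simp

end Summit.Parity.BatemanHorn.Cruxes.SplitBlockJacobi.CofactorRootDiscrepancy.Poisson

namespace Summit.Parity.BatemanHorn.Cruxes.SplitBlockJacobi.CofactorRootDiscrepancy

/-- **Registered stub form** of `Poisson.bulk_cell_eq_rect`: the identical statement, declared in the crux
namespace under the name registered on stmt-Parity-11583 (`ledger workitem stub-add`). -/
theorem bulk_cell_eq_rect :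
    ∀ (θ : ℝ) (x : ℕ) {X : ℝ} (hX : X ≤ (x : ℝ) ^ 2) {g : ℕ → ℕ} (hg : Monotone g) (hg0 : g 0 = ⌊(x : ℝ) ^ θ⌋₊) {i j : ℕ} (hij : i < j) (hgood : ((g (i + 1) * g (j + 1) : ℕ) : ℝ) ≤ X), ((((Finset.range ((x : ℕ) ^ 2 + 2) ×ˢ Finset.range ((x : ℕ) ^ 2 + 2)).filter (fun q : ℕ × ℕ => q.1.Prime ∧ q.2.Prime ∧ q.1 % 4 = 1 ∧ q.2 % 4 = 1 ∧ ((x : ℕ) : ℝ) ^ (θ : ℝ) < (q.1 : ℝ) ∧ q.1 < q.2 ∧ q.1 * q.2 ≤ (x : ℕ) ^ 2 + 1)).filter (fun q : ℕ × ℕ => ((q.1 * q.2 : ℕ) : ℝ) ≤ (X : ℝ)))).filter (fun q : ℕ × ℕ => q.1 ∈ Finset.Ioc (g i) (g (i + 1)) ∧ q.2 ∈ Finset.Ioc (g j) (g (j + 1))) = (Finset.Ioc (g i) (g (i + 1)) ×ˢ Finset.Ioc (g j) (g (j + 1))).filter (fun q : ℕ × ℕ => (q.1.Prime ∧ q.1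 % 4 = 1) ∧ (q.2.Prime ∧ q.2 % 4 = 1)) :=
  @Poisson.bulk_cell_eq_rect

end Summit.Parity.BatemanHorn.Cruxes.SplitBlockJacobi.CofactorRootDiscrepancy

end
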